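import Summits.ABC.ABC.Theorems.TowerFourSubLiouville.Negative.DialCalibration

/-!
# `TowerFourSubLiouville` (stmt-ABC-1649): the genus-one transfer targets `HallLang1728 κ` and
# `UniformLjunggren K` — floors `κ ≥ 3/2`, `K ≥ 1/2` by an explicit identity

Negative-side calibration (standing disprover, cycle 8, refuter-cdisprove-stmt-ABC-1649-g8-0, 2026-08-16) of the
TRANSFER proposed by the round-2 idea card `cm-hall-lang-transfer` (ideator 5; companion `two-division-descent-anchor`).
The card's lever: a coprime violator `w Z⁴ = v Y⁴ + a` of the crux's Thue normal form is the INTEGRAL point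
`(x, y) = (v w Y², v w² Y Z²)` on the `j = 1728` twist `E_N : y² = x³ + N x`, `N = a v w²`
(`Cruxes/…/SketchIdeator5.lean: integralPoint_of_violator`), with `x ≥ |N|^{1/(2η)}` in the enemy regime; so
the crux would follow from either of the two targets (stated in `SketchIdeator5.lean`, inlined verbatim below)

* `HallLang1728 κ  := ∃ C > 0, ∀ N x y : ℤ, N ≠ 0 → y² = x³ + N x → |x| ≤ C |N|^κ`,
* `UniformLjunggren K := ∃ C > 0, ∀ d k x y : ℤ, d ≠ □ → k ≠ 0 → x² − d y⁴ = k → |y| ≤ C (|d| |k|)^K`,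

for ANY exponent (`UniformLjunggren K ⟹ UBQ η` for `η < 1/(4K+2)`, `HallLang1728 κ ⟹ UniformLjunggren`-type
bookkeeping with `κ ↔ 2K + 1`).  This file pins both dials from below, unconditionally, by ONE polynomial identity
(`ljunggrenFamily₂_identity`, found as the truncated unit multiple `s³(s² + 4s + 6)`, `s = t + √(t² + 2)`, in
`ℚ[s, 1/s] = ℚ[t, √(t²+2)]`):

  `(16t⁵ + 32t⁴ + 64t³ + 64t² + 56t + 16)² − (t² + 2)·(4t² + 4t + 4)⁴ = −64·(3t² + 4t + 4)`,

a solution of `x² − d y⁴ = k` by polynomials of degrees `(deg d, deg y, deg k) = (2, 2, 2)` — EXTREMAL for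
Mason–Stothers (`deg y ≤ deg d/2 + deg k − 1`).  Consequences (sorry-free):

* `not_uniformLjunggren_of_lt_half`: `UniformLjunggren K` FAILS for every `K < 1/2`
  (`|y| = 4t² + 4t + 4 ≥ t²` against `|d|·|k| = 64(t²+2)(3t²+4t+4) ≤ 2112 t⁴`; `t² + 2` is never a square);
* `not_hallLang1728_of_lt_three_halves`: `HallLang1728 κ` FAILS for every `κ < 3/2`: the integral points
  `x = (t²+2)(4t²+4t+4)² ≥ t⁶`, `N = −64(t²+2)(3t²+4t+4)`, `|N| ≤ 2112 t⁴`, `y = (t²+2)(4t²+4t+4)(16t⁵+…+16)` lie on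
  `y² = x³ + N x` (`hallLangFamily₂_onCurve`; dictionary `x = d y'²`, `N = d k`, `y = d y' x'` for `x'² − d y'⁴ = k`).

Calibration summary for planners / the lead (details and the upper side in `Cruxes/TowerFourSubLiouville/Disproof.lean`,
§ Cycle 8): `ABC ⟹ UniformLjunggren K` for every `K > 1` (indeed `|y| ≪ d^{1/2+ε}|k|^{1+ε}`: in `x² = d y⁴ + k` reduced by
`g = gcd(d y⁴, k)` the `g` CANCELS, `x² < C_ε g^{−ε}(d|y||k||x|)^{1+ε}`) and `ABC ⟹ HallLang1728 κ` for every `κ > 2`; the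
random model (`k` spread over `|k| ≲ 2√d·y²`) puts the thresholds at exactly `K = 1`, `κ = 2`.  So the transfer target is:
proved false below `1/2` (resp. `3/2`), conjecturally false below `1` (resp. `2`), `ABC`-true above `1` (resp. `2`) — no
refutation of `∃ K` / `∃ κ` short of `¬ABC`, as for the crux itself; and the crux receives from it at best `η < 1/(4K+2) ≤ 1/6`.
Identity enemies of higher degree `μ = deg y` (extremal: `deg k = μ`, floors `K ≥ μ/(μ+2) → 1`, `κ ≥ (2μ+2)/(μ+2) → 2`, i.e.
exactly the heuristic values) correspond to truncated unit multiples `s^{μ+1}P_μ(s)`; they are rational for `μ = 1`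
(`ljunggrenFamily₁_identity`: `(4t³+4t²+3t+2)² − (t²+1)(2t+1)⁴ = 4t + 3`, `s²(s+2)`, `e = 1`) and `μ = 2` (this file, `e = 2`),
but the `μ = 3` scheme is defined only over the quartic field of `4e⁴ − 612e³ + 16848e² − 151632e + 295245` and the `μ = 4`
scheme over a field of degree `> 10` (numerical algebra, cycle 8): beyond `3/2` / `1/2` only near-extremal curves remain.
No statement here is a Theses decl; nothing positive about the crux is asserted.
-/

-- `Summit.ABC.ABC` is the mandated summit-side namespace (CONVENTIONS §2); the duplicate is deliberate.
set_option linter.dupNamespace false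

namespace Summit.ABC.ABC.Theorems.TowerFourSubLiouville.Negative

/-- Real-exponent bookkeeping: `(t⁴)^κ = (t⁶)^{2κ/3}` for `t ≥ 0`. -/
theorem rpow_four_eq_rpow_six {t : ℝ} (ht : 0 ≤ t) (κ : ℝ) : (t ^ 4) ^ κ = (t ^ 6) ^ (2 * κ / 3) := by
  rw [← Real.rpow_natCast t 4, ← Real.rpow_mul ht, ← Real.rpow_natCast t 6, ← Real.rpow_mul ht]
  congr 1
  push_cast
  ring

/-- Real-exponent bookkeeping: `(t⁴)^K = (t²)^{2K}` for `t ≥ 0`. -/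
theorem rpow_four_eq_rpow_two {t : ℝ} (ht : 0 ≤ t) (K : ℝ) : (t ^ 4) ^ K = (t ^ 2) ^ (2 * K) := by
  rw [← Real.rpow_natCast t 4, ← Real.rpow_mul ht, ← Real.rpow_natCast t 2, ← Real.rpow_mul ht]
  congr 1
  push_cast
  ring

/-! ## The identities -/

/-- Degree-1 extremal family (`s²(s + 2)`, `s = t + √(t²+1)`): `x² − d y⁴ = k` with
`(d, y, k) = (t² + 1, 2t + 1, 4t + 3)`.  (Floors `K ≥ 1/3`, `κ ≥ 4/3`; superseded by the degree-2 family.) -/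
theorem ljunggrenFamily₁_identity (t : ℤ) :
    (4 * t ^ 3 + 4 * t ^ 2 + 3 * t + 2) ^ 2 - (t ^ 2 + 1) * (2 * t + 1) ^ 4 = 4 * t + 3 := by
  ring

/-- Degree-2 extremal family (`s³(s² + 4s + 6)`, `s = t + √(t²+2)`): `x² − d y⁴ = k` with
`(d, y, k) = (t² + 2, 4t² + 4t + 4, −64(3t² + 4t + 4))`. -/
theorem ljunggrenFamily₂_identity (t : ℤ) :
    (16 * t ^ 5 + 32 * t ^ 4 + 64 * t ^ 3 + 64 * t ^ 2 + 56 * t + 16) ^ 2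
      - (t ^ 2 + 2) * (4 * t ^ 2 + 4 * t + 4) ^ 4 = -(64 * (3 * t ^ 2 + 4 * t + 4)) := by
  ring

/-- The same family as integral points on the `j = 1728` twists `y² = x³ + N x`:
`x = (t²+2)(4t²+4t+4)²`, `N = −64(t²+2)(3t²+4t+4)`, `y = (t²+2)(4t²+4t+4)(16t⁵+32t⁴+64t³+64t²+56t+16)`. -/
theorem hallLangFamily₂_onCurve (t : ℤ) :
    ((t ^ 2 + 2) * (4 * t ^ 2 + 4 * t + 4) *
        (16 * t ^ 5 + 32 * t ^ 4 + 64 * t ^ 3 + 64 * t ^ 2 + 56 * t + 16)) ^ 2 =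
      ((t ^ 2 + 2) * (4 * t ^ 2 + 4 * t + 4) ^ 2) ^ 3 +
        (-(64 * (t ^ 2 + 2) * (3 * t ^ 2 + 4 * t + 4))) * ((t ^ 2 + 2) * (4 * t ^ 2 + 4 * t + 4) ^ 2) := by
  ring

/-- `t² + 2` is not a square for `t ≥ 1` (it lies strictly between `t²` and `(t+1)²`). -/
theorem not_isSquare_sq_add_two {t : ℤ} (ht : 1 ≤ t) : ¬ IsSquare (t ^ 2 + 2) := by
  rintro ⟨r, hr⟩
  set u : ℤ := |r| with hu
  have hu0 : 0 ≤ u := abs_nonneg r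
  have hu2 : u * u = t ^ 2 + 2 := by rw [hr, hu, abs_mul_abs_self]
  have h1 : t < u := by
    by_contra hle
    have hle : u ≤ t := le_of_not_gt hle
    have : u * u ≤ t * t := mul_le_mul hle hle hu0 (by linarith)
    nlinarith
  have h2 : u < t + 1 := by
    by_contra hle
    have hle : t + 1 ≤ u := le_of_not_gt hle
    have : (t + 1) * (t + 1) ≤ u * u := mul_le_mul hle hle (by linarith) hu0
    nlinarith
  omega

/-! ## Size bookkeeping of the family (for `t ≥ 1`) -/

/-- `3t² + 4t + 4 > 0` for `t ≥ 1`. -/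
theorem family₂_quad_pos {t : ℤ} (ht : 1 ≤ t) : 0 < 3 * t ^ 2 + 4 * t + 4 := by nlinarith

/-- `x = (t²+2)(4t²+4t+4)² ≥ t⁶` for `t ≥ 1`. -/
theorem family₂_x_lower {t : ℤ} (ht : 1 ≤ t) : t ^ 6 ≤ (t ^ 2 + 2) * (4 * t ^ 2 + 4 * t + 4) ^ 2 := by
  have hA : 4 * t ^ 2 ≤ 4 * t ^ 2 + 4 * t + 4 := by nlinarith
  have hA0 : 0 ≤ 4 * t ^ 2 := by positivity
  have hA2 : (4 * t ^ 2) * (4 * t ^ 2) ≤ (4 * t ^ 2 + 4 * t + 4) * (4 * t ^ 2 + 4 * t + 4) :=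
    mul_le_mul hA hA hA0 (hA0.trans hA)
  have hB : t ^ 2 ≤ t ^ 2 + 2 := by linarith
  have h : t ^ 2 * ((4 * t ^ 2) * (4 * t ^ 2)) ≤ (t ^ 2 + 2) * ((4 * t ^ 2 + 4 * t + 4) * (4 * t ^ 2 + 4 * t + 4)) :=
    mul_le_mul hB hA2 (by positivity) (by positivity)
  have h6 : (0 : ℤ) ≤ t ^ 6 := by positivity
  calc t ^ 6 ≤ 16 * t ^ 6 := by linarith
    _ = t ^ 2 * ((4 * t ^ 2) * (4 * t ^ 2)) := by ring
    _ ≤ (t ^ 2 + 2) * ((4 * t ^ 2 + 4 * t + 4) * (4 * t ^ 2 + 4 * t + 4)) := h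
    _ = (t ^ 2 + 2) * (4 * t ^ 2 + 4 * t + 4) ^ 2 := by ring

/-- `x > 0`. -/
theorem family₂_x_pos {t : ℤ} (ht : 1 ≤ t) : 0 < (t ^ 2 + 2) * (4 * t ^ 2 + 4 * t + 4) ^ 2 :=
  lt_of_lt_of_le (by positivity) (family₂_x_lower ht)

/-- `y = 4t² + 4t + 4 ≥ t²` for `t ≥ 1`. -/
theorem family₂_y_lower {t : ℤ} (ht : 1 ≤ t) : t ^ 2 ≤ 4 * t ^ 2 + 4 * t + 4 := by nlinarith

/-- `y > 0`. -/
theorem family₂_y_pos {t : ℤ} (ht : 1 ≤ t) : 0 < 4 * t ^ 2 + 4 * t + 4 :=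
  lt_of_lt_of_le (by positivity) (family₂_y_lower ht)

/-- `|d|·|k| = 64(t²+2)(3t²+4t+4) ≤ 2112 t⁴` for `t ≥ 1`. -/
theorem family₂_dk_upper {t : ℤ} (ht : 1 ≤ t) :
    64 * (t ^ 2 + 2) * (3 * t ^ 2 + 4 * t + 4) ≤ 2112 * t ^ 4 := by
  have ht2 : 1 ≤ t ^ 2 := by nlinarith
  have hd : t ^ 2 + 2 ≤ 3 * t ^ 2 := by linarith
  have hq : 3 * t ^ 2 + 4 * t + 4 ≤ 11 * t ^ 2 := by nlinarith
  have h : (t ^ 2 + 2) * (3 * t ^ 2 + 4 * t + 4) ≤ (3 * t ^ 2) * (11 * t ^ 2) :=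
    mul_le_mul hd hq (family₂_quad_pos ht).le (by positivity)
  calc 64 * (t ^ 2 + 2) * (3 * t ^ 2 + 4 * t + 4) = 64 * ((t ^ 2 + 2) * (3 * t ^ 2 + 4 * t + 4)) := by ring
    _ ≤ 64 * ((3 * t ^ 2) * (11 * t ^ 2)) := by linarith
    _ = 2112 * t ^ 4 := by ring

/-- `N = −64(t²+2)(3t²+4t+4) ≠ 0`. -/
theorem family₂_N_ne_zero {t : ℤ} (ht : 1 ≤ t) : -(64 * (t ^ 2 + 2) * (3 * t ^ 2 + 4 * t + 4)) ≠ 0 := by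
  have : 0 < 64 * (t ^ 2 + 2) * (3 * t ^ 2 + 4 * t + 4) :=
    mul_pos (mul_pos (by norm_num) (by positivity)) (family₂_quad_pos ht)
  linarith

/-- `|N| ≤ 2112 t⁴`. -/
theorem family₂_N_abs {t : ℤ} (ht : 1 ≤ t) : |-(64 * (t ^ 2 + 2) * (3 * t ^ 2 + 4 * t + 4))| ≤ 2112 * t ^ 4 := by
  have : 0 < 64 * (t ^ 2 + 2) * (3 * t ^ 2 + 4 * t + 4) :=
    mul_pos (mul_pos (by norm_num) (by positivity)) (family₂_quad_pos ht)
  rw [abs_neg, abs_of_pos this]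
  exact family₂_dk_upper ht

/-- `k = −64(3t²+4t+4) ≠ 0`. -/
theorem family₂_k_ne_zero {t : ℤ} (ht : 1 ≤ t) : -(64 * (3 * t ^ 2 + 4 * t + 4)) ≠ 0 := by
  have : 0 < 64 * (3 * t ^ 2 + 4 * t + 4) := mul_pos (by norm_num) (family₂_quad_pos ht)
  linarith

/-- `|d|·|k| ≤ 2112 t⁴` in the shape of the `UniformLjunggren` matrix. -/
theorem family₂_dk_abs {t : ℤ} (ht : 1 ≤ t) : |t ^ 2 + 2| * |-(64 * (3 * t ^ 2 + 4 * t + 4))| ≤ 2112 * t ^ 4 := by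
  have hk : 0 < 64 * (3 * t ^ 2 + 4 * t + 4) := mul_pos (by norm_num) (family₂_quad_pos ht)
  have hd : 0 < t ^ 2 + 2 := by positivity
  rw [abs_neg, abs_of_pos hk, abs_of_pos hd]
  calc (t ^ 2 + 2) * (64 * (3 * t ^ 2 + 4 * t + 4)) = 64 * (t ^ 2 + 2) * (3 * t ^ 2 + 4 * t + 4) := by ring
    _ ≤ 2112 * t ^ 4 := family₂_dk_upper ht

/-- `|d|·|k| ≥ 1`. -/
theorem family₂_dk_one_le {t : ℤ} (ht : 1 ≤ t) : 1 ≤ |t ^ 2 + 2| * |-(64 * (3 * t ^ 2 + 4 * t + 4))| := by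
  have h1 : 1 ≤ |t ^ 2 + 2| := Int.one_le_abs (by positivity)
  have h2 : 1 ≤ |-(64 * (3 * t ^ 2 + 4 * t + 4))| := Int.one_le_abs (family₂_k_ne_zero ht)
  nlinarith

/-- A large integer parameter beyond any real threshold. -/
theorem exists_int_param (M : ℝ) : ∃ t : ℤ, 1 ≤ t ∧ M ≤ (t : ℝ) := by
  obtain ⟨n, hn⟩ := exists_nat_gt (max M 1)
  refine ⟨(n : ℤ), ?_, ?_⟩
  · have : (1 : ℝ) < (n : ℝ) := lt_of_le_of_lt (le_max_right _ _) hn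
    exact_mod_cast this.le
  · have : M < (n : ℝ) := lt_of_le_of_lt (le_max_left _ _) hn
    rw [Int.cast_natCast]
    exact this.le

/-! ## `HallLang1728 κ` fails for every `κ < 3/2` -/

/-- **Hall–Lang for the `j = 1728` family needs `κ ≥ 3/2`.**  The matrix is `SketchIdeator5.HallLang1728 κ`
verbatim.  Witness: the integral points of `hallLangFamily₂_onCurve`, `x ≥ t⁶` against `|N| ≤ 2112 t⁴`. -/
theorem not_hallLang1728_of_lt_three_halves (κ : ℝ) (hκ : κ < 3 / 2) :
    ¬ ∃ C : ℝ, 0 < C ∧ ∀ N x y : ℤ, N ≠ 0 → y ^ 2 = x ^ 3 + N * x →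
      (|x| : ℝ) ≤ C * (|N| : ℝ) ^ κ := by
  rintro ⟨C, hC, h⟩
  -- reduce to a nonnegative exponent `κ' = max κ 0 ∈ [0, 3/2)`
  set κ' : ℝ := max κ 0 with hκ'def
  have hκ'0 : 0 ≤ κ' := le_max_right _ _
  have hκ'lt : κ' < 3 / 2 := max_lt hκ (by norm_num)
  have hs : 2 * κ' / 3 < 1 := by linarith
  obtain ⟨M, -, hM⟩ := key_growth (K := 2 * C * (2112 : ℝ) ^ κ') (by positivity) hs
  obtain ⟨t, ht1, htM⟩ := exists_int_param M
  have ht1R : (1 : ℝ) ≤ (t : ℝ) := by exact_mod_cast ht1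
  have ht0R : (0 : ℝ) ≤ (t : ℝ) := by linarith
  -- the integral point
  have key := h (-(64 * (t ^ 2 + 2) * (3 * t ^ 2 + 4 * t + 4))) ((t ^ 2 + 2) * (4 * t ^ 2 + 4 * t + 4) ^ 2)
    ((t ^ 2 + 2) * (4 * t ^ 2 + 4 * t + 4) *
      (16 * t ^ 5 + 32 * t ^ 4 + 64 * t ^ 3 + 64 * t ^ 2 + 56 * t + 16))
    (family₂_N_ne_zero ht1) (hallLangFamily₂_onCurve t)
  -- sizes, cast to ℝ
  have hX1 : (t : ℝ) ^ 6 ≤ (((t ^ 2 + 2) * (4 * t ^ 2 + 4 * t + 4) ^ 2 : ℤ) : ℝ) := by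
    exact_mod_cast family₂_x_lower ht1
  have hXabs : |(((t ^ 2 + 2) * (4 * t ^ 2 + 4 * t + 4) ^ 2 : ℤ) : ℝ)| =
      (((t ^ 2 + 2) * (4 * t ^ 2 + 4 * t + 4) ^ 2 : ℤ) : ℝ) :=
    abs_of_pos (by exact_mod_cast family₂_x_pos ht1)
  have hN1 : |((-(64 * (t ^ 2 + 2) * (3 * t ^ 2 + 4 * t + 4)) : ℤ) : ℝ)| ≤ 2112 * (t : ℝ) ^ 4 := by
    rw [← Int.cast_abs]; exact_mod_cast family₂_N_abs ht1
  have hNone : (1 : ℝ) ≤ |((-(64 * (t ^ 2 + 2) * (3 * t ^ 2 + 4 * t + 4)) : ℤ) : ℝ)| := by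
    rw [← Int.cast_abs]; exact_mod_cast Int.one_le_abs (family₂_N_ne_zero ht1)
  -- growth
  have hT : M ≤ (t : ℝ) ^ 6 :=
    le_trans htM (by simpa using pow_le_pow_right₀ ht1R (show 1 ≤ 6 by norm_num))
  have h4 := hM ((t : ℝ) ^ 6) hT
  have h3 : ((2112 : ℝ) * (t : ℝ) ^ 4) ^ κ' = (2112 : ℝ) ^ κ' * ((t : ℝ) ^ 6) ^ (2 * κ' / 3) := by
    rw [Real.mul_rpow (by norm_num) (by positivity), rpow_four_eq_rpow_six ht0R]
  have ht6 : (0 : ℝ) < (t : ℝ) ^ 6 := by positivity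
  have h5 : C * (2112 : ℝ) ^ κ' * ((t : ℝ) ^ 6) ^ (2 * κ' / 3) < (t : ℝ) ^ 6 := by linarith
  have : |(((t ^ 2 + 2) * (4 * t ^ 2 + 4 * t + 4) ^ 2 : ℤ) : ℝ)| <
      |(((t ^ 2 + 2) * (4 * t ^ 2 + 4 * t + 4) ^ 2 : ℤ) : ℝ)| :=
    calc |(((t ^ 2 + 2) * (4 * t ^ 2 + 4 * t + 4) ^ 2 : ℤ) : ℝ)|
        ≤ C * |((-(64 * (t ^ 2 + 2) * (3 * t ^ 2 + 4 * t + 4)) : ℤ) : ℝ)| ^ κ := key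
      _ ≤ C * |((-(64 * (t ^ 2 + 2) * (3 * t ^ 2 + 4 * t + 4)) : ℤ) : ℝ)| ^ κ' :=
          mul_le_mul_of_nonneg_left (Real.rpow_le_rpow_of_exponent_le hNone (le_max_left _ _)) hC.le
      _ ≤ C * ((2112 : ℝ) * (t : ℝ) ^ 4) ^ κ' :=
          mul_le_mul_of_nonneg_left (Real.rpow_le_rpow (abs_nonneg _) hN1 hκ'0) hC.le
      _ = C * (2112 : ℝ) ^ κ' * ((t : ℝ) ^ 6) ^ (2 * κ' / 3) := by rw [h3]; ring
      _ < (t : ℝ) ^ 6 := h5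
      _ ≤ (((t ^ 2 + 2) * (4 * t ^ 2 + 4 * t + 4) ^ 2 : ℤ) : ℝ) := hX1
      _ = |(((t ^ 2 + 2) * (4 * t ^ 2 + 4 * t + 4) ^ 2 : ℤ) : ℝ)| := hXabs.symm
  exact lt_irrefl _ this

/-! ## `UniformLjunggren K` fails for every `K < 1/2` -/

/-- **Uniform Ljunggren needs `K ≥ 1/2`.**  The matrix is `SketchIdeator5.UniformLjunggren K` verbatim.
Witness: `ljunggrenFamily₂_identity`, `|y| = 4t² + 4t + 4 ≥ t²` against `|d|·|k| ≤ 2112 t⁴`. -/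
theorem not_uniformLjunggren_of_lt_half (K : ℝ) (hK : K < 1 / 2) :
    ¬ ∃ C : ℝ, 0 < C ∧ ∀ d k x y : ℤ, ¬ IsSquare d → k ≠ 0 → x ^ 2 - d * y ^ 4 = k →
      (|y| : ℝ) ≤ C * ((|d| * |k| : ℤ) : ℝ) ^ K := by
  rintro ⟨C, hC, h⟩
  set K' : ℝ := max K 0 with hK'def
  have hK'0 : 0 ≤ K' := le_max_right _ _
  have hK'lt : K' < 1 / 2 := max_lt hK (by norm_num)
  have hs : 2 * K' < 1 := by linarith
  obtain ⟨M, -, hM⟩ := key_growth (K := 2 * C * (2112 : ℝ) ^ K') (by positivity) hs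
  obtain ⟨t, ht1, htM⟩ := exists_int_param M
  have ht1R : (1 : ℝ) ≤ (t : ℝ) := by exact_mod_cast ht1
  have ht0R : (0 : ℝ) ≤ (t : ℝ) := by linarith
  -- the solution of `x² − d y⁴ = k`
  have key := h (t ^ 2 + 2) (-(64 * (3 * t ^ 2 + 4 * t + 4)))
    (16 * t ^ 5 + 32 * t ^ 4 + 64 * t ^ 3 + 64 * t ^ 2 + 56 * t + 16) (4 * t ^ 2 + 4 * t + 4)
    (not_isSquare_sq_add_two ht1) (family₂_k_ne_zero ht1) (ljunggrenFamily₂_identity t)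
  -- sizes, cast to ℝ
  have hY1 : (t : ℝ) ^ 2 ≤ (((4 * t ^ 2 + 4 * t + 4) : ℤ) : ℝ) := by exact_mod_cast family₂_y_lower ht1
  have hYabs : |(((4 * t ^ 2 + 4 * t + 4) : ℤ) : ℝ)| = (((4 * t ^ 2 + 4 * t + 4) : ℤ) : ℝ) :=
    abs_of_pos (by exact_mod_cast family₂_y_pos ht1)
  have hR1 : (((|t ^ 2 + 2| * |-(64 * (3 * t ^ 2 + 4 * t + 4))|) : ℤ) : ℝ) ≤ 2112 * (t : ℝ) ^ 4 := by
    exact_mod_cast family₂_dk_abs ht1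
  have hRone : (1 : ℝ) ≤ (((|t ^ 2 + 2| * |-(64 * (3 * t ^ 2 + 4 * t + 4))|) : ℤ) : ℝ) := by
    exact_mod_cast family₂_dk_one_le ht1
  have hR0 : (0 : ℝ) ≤ (((|t ^ 2 + 2| * |-(64 * (3 * t ^ 2 + 4 * t + 4))|) : ℤ) : ℝ) :=
    le_trans zero_le_one hRone
  -- growth
  have hT : M ≤ (t : ℝ) ^ 2 :=
    le_trans htM (by simpa using pow_le_pow_right₀ ht1R (show 1 ≤ 2 by norm_num))
  have h4 := hM ((t : ℝ) ^ 2) hT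
  have h3 : ((2112 : ℝ) * (t : ℝ) ^ 4) ^ K' = (2112 : ℝ) ^ K' * ((t : ℝ) ^ 2) ^ (2 * K') := by
    rw [Real.mul_rpow (by norm_num) (by positivity), rpow_four_eq_rpow_two ht0R]
  have ht2 : (0 : ℝ) < (t : ℝ) ^ 2 := by positivity
  have h5 : C * (2112 : ℝ) ^ K' * ((t : ℝ) ^ 2) ^ (2 * K') < (t : ℝ) ^ 2 := by linarith
  have : |(((4 * t ^ 2 + 4 * t + 4) : ℤ) : ℝ)| < |(((4 * t ^ 2 + 4 * t + 4) : ℤ) : ℝ)| :=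
    calc |(((4 * t ^ 2 + 4 * t + 4) : ℤ) : ℝ)|
        ≤ C * (((|t ^ 2 + 2| * |-(64 * (3 * t ^ 2 + 4 * t + 4))|) : ℤ) : ℝ) ^ K := key
      _ ≤ C * (((|t ^ 2 + 2| * |-(64 * (3 * t ^ 2 + 4 * t + 4))|) : ℤ) : ℝ) ^ K' :=
          mul_le_mul_of_nonneg_left (Real.rpow_le_rpow_of_exponent_le hRone (le_max_left _ _)) hC.le
      _ ≤ C * ((2112 : ℝ) * (t : ℝ) ^ 4) ^ K' :=
          mul_le_mul_of_nonneg_left (Real.rpow_le_rpow hR0 hR1 hK'0) hC.le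
      _ = C * (2112 : ℝ) ^ K' * ((t : ℝ) ^ 2) ^ (2 * K') := by rw [h3]; ring
      _ < (t : ℝ) ^ 2 := h5
      _ ≤ (((4 * t ^ 2 + 4 * t + 4) : ℤ) : ℝ) := hY1
      _ = |(((4 * t ^ 2 + 4 * t + 4) : ℤ) : ℝ)| := hYabs.symm
  exact lt_irrefl _ this

end Summit.ABC.ABC.Theorems.TowerFourSubLiouville.Negative
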